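import Summits.Ventures.PercRepro.ProfilePointedCircuitClassesStarSharpDefectE
import Summits.Ventures.PercRepro.ProfilePointedCircuitClassesStarSharpLoopG
import Summits.Ventures.PercRepro.ProfilePointedCircuitClassesStarSharpParB

/-!
# PercRepro — THE LOOP AND PARALLEL REGIMES OF CASE D0, UNCONDITIONALLY
(p5, gen 55; `proofs/P5-GM1.md` §82 ADD 6)

`card_d0Def_le_three` (the defects of `R` are at most three) discharges the instance condition «at most three demands
without a swap» of `inCount_thru_le_of_loop_of_le_three_bad`, `inCount_thru_le_of_par_f_of_le_three_bad` and
`inCount_thru_le_of_par_e_of_le_three_bad`: in each regime the demands of the class are defects of `R`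
(`hthree_of_defects`).  The three regime theorems `inCount_thru_le_of_loop`, `inCount_thru_le_of_par_f`,
`inCount_thru_le_of_par_e` carry only the standing hypotheses of case D0 and the regime's rank condition.
-/

open scoped Matroid

namespace PercRepro.Cogirth

open Finset ThmH Skew Shadow Profile

open Classical

variable {α : Type} [DecidableEq α] {N : Matroid α} [N.Finite]

section StarSharpRegimes

variable {b b' : α}

/-- Four elements of a set of at most three elements: two coincide. -/
theorem two_eq_of_four_mem_card_le_three {β : Type} [DecidableEq β] {s : Finset β} (hs : s.card ≤ 3) {x y z w : β}
    (hx : x ∈ s) (hy : y ∈ s) (hz : z ∈ s) (hw : w ∈ s) :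
    x = y ∨ x = z ∨ x = w ∨ y = z ∨ y = w ∨ z = w := by
  by_contra hcon
  push Not at hcon
  obtain ⟨hxy, hxz, hxw, hyz, hyw, hzw⟩ := hcon
  have h4 : ({x, y, z, w} : Finset β).card = 4 := by
    rw [card_insert_of_notMem, card_insert_of_notMem, card_pair hzw]
    · simp only [mem_insert, mem_singleton, not_or]; exact ⟨hyz, hyw⟩
    · simp only [mem_insert, mem_singleton, not_or]; exact ⟨hxy, hxz, hxw⟩
  have hsub : ({x, y, z, w} : Finset β) ⊆ s := by
    intro u hu
    simp only [mem_insert, mem_singleton] at hu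
    rcases hu with rfl | rfl | rfl | rfl
    · exact hx
    · exact hy
    · exact hz
    · exact hw
  have := card_le_card hsub
  omega

/-- **THE INSTANCE CONDITION IS A THEOREM**: four ON demands whose pairs are defects of `R` are not pairwise
distinct. -/
theorem hthree_of_defects (hn : (gr N).card = 9) (h : SeriesPair N b b') {e f : α} (he : e ∈ gr N) (hf : f ∈ gr N)
    (hef : e ≠ f) (heb : e ≠ b) (heb' : e ≠ b') (hfb : f ≠ b) (hfb' : f ≠ b')
    (he1 : ∀ y ∈ ((((gr N).erase b).erase b').erase f).erase e, rk N {e, y} = 2)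
    (hf1 : ∀ y ∈ ((((gr N).erase b).erase b').erase f).erase e, rk N {f, y} = 2)
    (hfc : ∀ y ∈ ((((gr N).erase b).erase b').erase f).erase e, rk N (((((gr N).erase b).erase b').erase f).erase y) = 4)
    (hX : rk N (((((gr N).erase b).erase b').erase f).erase e) = 4) :
    ∀ W₁ ∈ d0DON N b' e f, ∀ W₂ ∈ d0DON N b' e f, ∀ W₃ ∈ d0DON N b' e f, ∀ W₄ ∈ d0DON N b' e f,
      ¬ (rk N (insert f ((W₁.erase b).erase e)) = 3 ∧
        rk N (insert e (((((gr N).erase b).erase b').erase f).erase e \ (W₁.erase b).erase e)) = 4) →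
      ¬ (rk N (insert f ((W₂.erase b).erase e)) = 3 ∧
        rk N (insert e (((((gr N).erase b).erase b').erase f).erase e \ (W₂.erase b).erase e)) = 4) →
      ¬ (rk N (insert f ((W₃.erase b).erase e)) = 3 ∧
        rk N (insert e (((((gr N).erase b).erase b').erase f).erase e \ (W₃.erase b).erase e)) = 4) →
      ¬ (rk N (insert f ((W₄.erase b).erase e)) = 3 ∧
        rk N (insert e (((((gr N).erase b).erase b').erase f).erase e \ (W₄.erase b).erase e)) = 4) →
      W₁ = W₂ ∨ W₁ = W₃ ∨ W₁ = W₄ ∨ W₂ = W₃ ∨ W₂ = W₄ ∨ W₃ = W₄ := by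
  have hdata := d0_demand_data h hn hf hef heb hfb hfb' (e := e)
  have hmem : ∀ W ∈ d0DON N b' e f, ¬ (rk N (insert f ((W.erase b).erase e)) = 3 ∧
      rk N (insert e (((((gr N).erase b).erase b').erase f).erase e \ (W.erase b).erase e)) = 4) →
      (W.erase b).erase e ∈ d0Def N b b' e f ∧ insert b (insert e ((W.erase b).erase e)) = W := by
    intro W hW hP
    have hWd := hW
    simp only [d0DON, mem_filter] at hWd
    obtain ⟨-, hπX, hπ2, hπW, hbW, hπe, hYf, -⟩ := hdata W hWd.1 hWd.2.1 hWd.2.2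
    refine ⟨mem_d0Def.2 ⟨hπX, hπ2, hπe, hYf, hP⟩, ?_⟩
    rw [hπW, hbW]
  have hcard := card_d0Def_le_three hn h he hf hef heb heb' hfb hfb' he1 hf1 hfc hX
  intro W₁ h1 W₂ h2 W₃ h3 W₄ h4 hP1 hP2 hP3 hP4
  obtain ⟨hm1, he1'⟩ := hmem W₁ h1 hP1
  obtain ⟨hm2, he2'⟩ := hmem W₂ h2 hP2
  obtain ⟨hm3, he3'⟩ := hmem W₃ h3 hP3
  obtain ⟨hm4, he4'⟩ := hmem W₄ h4 hP4
  rcases two_eq_of_four_mem_card_le_three hcard hm1 hm2 hm3 hm4 with h' | h' | h' | h' | h' | h'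
  · exact Or.inl (by rw [← he1', ← he2', h'])
  · exact Or.inr (Or.inl (by rw [← he1', ← he3', h']))
  · exact Or.inr (Or.inr (Or.inl (by rw [← he1', ← he4', h'])))
  · exact Or.inr (Or.inr (Or.inr (Or.inl (by rw [← he2', ← he3', h']))))
  · exact Or.inr (Or.inr (Or.inr (Or.inr (Or.inl (by rw [← he2', ← he4', h'])))))
  · exact Or.inr (Or.inr (Or.inr (Or.inr (Or.inr (by rw [← he3', ← he4', h'])))))

/-- **THE LOOP REGIME** (`ρ{b, b′} = 1`, every set ON): the `b′`-avoiding inequality, with no instance condition. -/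
theorem inCount_thru_le_of_loop (hn : (gr N).card = 9) (h : SeriesPair N b b')
    {e f : α} (he : e ∈ gr N) (hf : f ∈ gr N) (hef : e ≠ f) (heb : e ≠ b) (heb' : e ≠ b') (hfb : f ≠ b) (hfb' : f ≠ b')
    (he1 : ∀ y ∈ ((((gr N).erase b).erase b').erase f).erase e, rk N {e, y} = 2)
    (hf1 : ∀ y ∈ ((((gr N).erase b).erase b').erase f).erase e, rk N {f, y} = 2)
    (hfc : ∀ y ∈ ((((gr N).erase b).erase b').erase f).erase e, rk N (((((gr N).erase b).erase b').erase f).erase y) = 4)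
    (hX : rk N (((((gr N).erase b).erase b').erase f).erase e) = 4) (hef2 : rk N {e, f} = 2)
    (hbb : rk N {b, b'} = 1) :
    inCount N 4 e + thruCount N 4 {b', f} + thruCount N 4 {b', e, f} ≤
      inCount N 4 f + thruCount N 4 {e, f} + thruCount N 4 {b', e} := by
  apply inCount_thru_le_of_loop_of_le_three_bad hn h he hf hef heb heb' hfb hfb' he1 hf1 hfc hX hef2 hbb
  have hbadC := defect_data_of_loop hn h he hf hef heb heb' hfb hfb' he1 hf1 hX hef2 hbb
  intro W₁ h1 W₂ h2 W₃ h3 W₄ h4 hc1 hc2 hc3 hc4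
  exact hthree_of_defects hn h he hf hef heb heb' hfb hfb' he1 hf1 hfc hX W₁ h1 W₂ h2 W₃ h3 W₄ h4
    (hbadC W₁ (mem_filter.2 ⟨h1, hc1⟩)).2.2.2.2.2.1 (hbadC W₂ (mem_filter.2 ⟨h2, hc2⟩)).2.2.2.2.2.1
    (hbadC W₃ (mem_filter.2 ⟨h3, hc3⟩)).2.2.2.2.2.1 (hbadC W₄ (mem_filter.2 ⟨h4, hc4⟩)).2.2.2.2.2.1

/-- **THE REGIME `b ∥ f`** (`ρ{f, b, b′} = 2`, `ρ{b, b′} = 2`): the `b′`-avoiding inequality, with no instance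
condition. -/
theorem inCount_thru_le_of_par_f (hn : (gr N).card = 9) (h : SeriesPair N b b')
    {e f : α} (he : e ∈ gr N) (hf : f ∈ gr N) (hef : e ≠ f) (heb : e ≠ b) (heb' : e ≠ b') (hfb : f ≠ b) (hfb' : f ≠ b')
    (he1 : ∀ y ∈ ((((gr N).erase b).erase b').erase f).erase e, rk N {e, y} = 2)
    (hf1 : ∀ y ∈ ((((gr N).erase b).erase b').erase f).erase e, rk N {f, y} = 2)
    (hfc : ∀ y ∈ ((((gr N).erase b).erase b').erase f).erase e, rk N (((((gr N).erase b).erase b').erase f).erase y) = 4)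
    (hX : rk N (((((gr N).erase b).erase b').erase f).erase e) = 4) (hef2 : rk N {e, f} = 2)
    (hpf : rk N {f, b, b'} = 2) (hbb2 : rk N {b, b'} = 2) :
    inCount N 4 e + thruCount N 4 {b', f} + thruCount N 4 {b', e, f} ≤
      inCount N 4 f + thruCount N 4 {e, f} + thruCount N 4 {b', e} := by
  apply inCount_thru_le_of_par_f_of_le_three_bad hn h he hf hef heb heb' hfb hfb' he1 hf1 hfc hX hef2 hpf hbb2
  have hfE : f ∈ ((gr N).erase b).erase b' := mem_erase.2 ⟨hfb', mem_erase.2 ⟨hfb, hf⟩⟩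
  have hXE : ((((gr N).erase b).erase b').erase f).erase e ⊆ ((gr N).erase b).erase b' :=
    (erase_subset _ _).trans (erase_subset _ _)
  have hf1' : rk N ({f} : Finset α) = 1 := by
    have h1 := rk_insert_le_add_one (N := N) he (X := ({f} : Finset α)) (singleton_subset_iff.2 hf)
    have h2 := rk_le_card' (M := N) ({f} : Finset α)
    rw [card_singleton] at h2
    rw [hef2] at h1
    omega
  have hon : ∀ S : Finset α, S ⊆ ((gr N).erase b).erase b' → f ∈ S → rk N (insert b (insert b' S)) = rk N S + 1 := by
    intro S hS hfS
    rw [on_iff_of_parallel h hfE hf1' hpf hbb2 hS, insert_eq_of_mem hfS]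
  have hdata := d0_demand_data h hn hf hef heb hfb hfb' (e := e)
  have hP : ∀ W ∈ d0DON N b' e f, ¬ d0c0 N b b' e f W → ¬ (rk N (insert f ((W.erase b).erase e)) = 3 ∧
      rk N (insert e (((((gr N).erase b).erase b').erase f).erase e \ (W.erase b).erase e)) = 4) := by
    intro W hW hc0
    have hWd := hW
    simp only [d0DON, mem_filter] at hWd
    obtain ⟨-, hπX, -, -, -, -, -, -⟩ := hdata W hWd.1 hWd.2.1 hWd.2.2
    rintro ⟨h1, h2⟩
    apply hc0
    exact ⟨h1, h2, by rw [hon _ (insert_subset hfE (hπX.trans hXE)) (mem_insert_self _ _), h1]⟩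
  intro W₁ h1 W₂ h2 W₃ h3 W₄ h4 hc1 hc2 hc3 hc4
  exact hthree_of_defects hn h he hf hef heb heb' hfb hfb' he1 hf1 hfc hX W₁ h1 W₂ h2 W₃ h3 W₄ h4
    (hP W₁ h1 hc1) (hP W₂ h2 hc2) (hP W₃ h3 hc3) (hP W₄ h4 hc4)

/-- **THE REGIME `b ∥ e`** (`ρ{e, b, b′} = 2`, `ρ{b, b′} = 2`): the `b′`-avoiding inequality, with no instance
condition. -/
theorem inCount_thru_le_of_par_e (hn : (gr N).card = 9) (h : SeriesPair N b b')
    {e f : α} (he : e ∈ gr N) (hf : f ∈ gr N) (hef : e ≠ f) (heb : e ≠ b) (heb' : e ≠ b') (hfb : f ≠ b) (hfb' : f ≠ b')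
    (he1 : ∀ y ∈ ((((gr N).erase b).erase b').erase f).erase e, rk N {e, y} = 2)
    (hf1 : ∀ y ∈ ((((gr N).erase b).erase b').erase f).erase e, rk N {f, y} = 2)
    (hfc : ∀ y ∈ ((((gr N).erase b).erase b').erase f).erase e, rk N (((((gr N).erase b).erase b').erase f).erase y) = 4)
    (hX : rk N (((((gr N).erase b).erase b').erase f).erase e) = 4) (hef2 : rk N {e, f} = 2)
    (hpe : rk N {e, b, b'} = 2) (hbb2 : rk N {b, b'} = 2) :
    inCount N 4 e + thruCount N 4 {b', f} + thruCount N 4 {b', e, f} ≤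
      inCount N 4 f + thruCount N 4 {e, f} + thruCount N 4 {b', e} := by
  apply inCount_thru_le_of_par_e_of_le_three_bad hn h he hf hef heb heb' hfb hfb' he1 hf1 hfc hX hef2 hpe hbb2
  have hfE : f ∈ ((gr N).erase b).erase b' := mem_erase.2 ⟨hfb', mem_erase.2 ⟨hfb, hf⟩⟩
  have heE : e ∈ ((gr N).erase b).erase b' := mem_erase.2 ⟨heb', mem_erase.2 ⟨heb, he⟩⟩
  have hXE : ((((gr N).erase b).erase b').erase f).erase e ⊆ ((gr N).erase b).erase b' :=
    (erase_subset _ _).trans (erase_subset _ _)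
  have he1' : rk N ({e} : Finset α) = 1 := by
    have h1 := rk_insert_le_add_one (N := N) hf (X := ({e} : Finset α)) (singleton_subset_iff.2 he)
    have h2 := rk_le_card' (M := N) ({e} : Finset α)
    rw [card_singleton] at h2
    rw [pair_comm'] at hef2
    rw [hef2] at h1
    omega
  have hon : ∀ S : Finset α, S ⊆ ((gr N).erase b).erase b' → e ∈ S → rk N (insert b (insert b' S)) = rk N S + 1 := by
    intro S hS heS
    rw [on_iff_of_parallel h heE he1' hpe hbb2 hS, insert_eq_of_mem heS]
  have hdata := d0_demand_data h hn hf hef heb hfb hfb' (e := e)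
  have hP : ∀ W ∈ d0DON N b' e f, ¬ d0c0 N b b' e f W ∧ ¬ (d0c1 N b e f W ∧ d0c2 N b b' e f W) →
      ¬ (rk N (insert f ((W.erase b).erase e)) = 3 ∧
        rk N (insert e (((((gr N).erase b).erase b').erase f).erase e \ (W.erase b).erase e)) = 4) := by
    intro W hW hcls
    have hWd := hW
    simp only [d0DON, mem_filter] at hWd
    obtain ⟨-, hπX, hπ2, -, -, hYr, hYc, -⟩ := hdata W hWd.1 hWd.2.1 hWd.2.2
    rintro ⟨h1, h2⟩
    -- the swap is OFF, so `ρ(π + e + f) = 4` (c1); then the complement is ON (¬ c2), against `hcls.2`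
    have hoffswap : ¬ rk N (insert b (insert b' (insert f ((W.erase b).erase e)))) = 4 := fun h' =>
      hcls.1 ⟨h1, h2, h'⟩
    have hsubE : insert f ((W.erase b).erase e) ⊆ ((gr N).erase b).erase b' := insert_subset hfE (hπX.trans hXE)
    have hc1 : d0c1 N b e f W := by
      unfold d0c1
      have h3 : ¬ rk N (insert e (insert f ((W.erase b).erase e))) = rk N (insert f ((W.erase b).erase e)) := by
        intro h4
        apply hoffswap
        rw [(on_iff_of_parallel h heE he1' hpe hbb2 hsubE).2 h4, h1]
      have h4 := rk_insert_le_add_one (N := N) he (X := insert f ((W.erase b).erase e))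
        (hsubE.trans ((erase_subset _ _).trans (erase_subset _ _)))
      have h5 : rk N (insert f ((W.erase b).erase e)) ≤ rk N (insert e (insert f ((W.erase b).erase e))) :=
        rk_mono' (subset_insert _ _)
      rw [insert_f_insert_e_comm]
      omega
    have hnc2 : ¬ d0c2 N b b' e f W := fun h' => hcls.2 ⟨hc1, h'⟩
    apply hnc2
    unfold d0c2
    have hXπE : ((((gr N).erase b).erase b').erase f).erase e \ (W.erase b).erase e ⊆ ((gr N).erase b).erase b' :=
      sdiff_subset.trans hXE
    have h3 := rk_insert_bb'_bounds h hXπE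
    have h4 : rk N (((((gr N).erase b).erase b').erase f).erase e \ (W.erase b).erase e) = 3 :=
      d0_S3 h hn he hf hef heb heb' hfb hfb' _ hπX hπ2 hYc
    have h5 : ¬ rk N (insert b (insert b' (((((gr N).erase b).erase b').erase f).erase e \ (W.erase b).erase e))) =
        rk N (((((gr N).erase b).erase b').erase f).erase e \ (W.erase b).erase e) + 1 := by
      rw [on_iff_of_parallel h heE he1' hpe hbb2 hXπE]
      omega
    omega
  intro W₁ h1 W₂ h2 W₃ h3 W₄ h4 hc1 hc2 hc3 hc4
  exact hthree_of_defects hn h he hf hef heb heb' hfb hfb' he1 hf1 hfc hX W₁ h1 W₂ h2 W₃ h3 W₄ h4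
    (hP W₁ h1 hc1) (hP W₂ h2 hc2) (hP W₃ h3 hc3) (hP W₄ h4 hc4)

end StarSharpRegimes

end PercRepro.Cogirth
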